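import Summits.Ventures.CertifiedArithmetic.LowPrec.DoubleRoundingProductTie
import Summits.Ventures.CertifiedArithmetic.LowPrec.DoubleRoundingStripLaws

/-!
# THEOREM D-dm at matrix level: the named `13 × 13` product matrix as one test, read by laws

HONEST FRAMING (venture CertifiedArithmetic / cell `pub-lowprec`): certified error envelopes and
provably optimal rounding/accumulation schemes for low-precision formats under stated cost models;
every table by two implementations; no hardware or vendor claims.

`DRMul X Y` (`DoubleRoundingProductUnderflow.lean`): for all data `a b` of `X`,
`fl_X (fl_Y (a · b)) = fl_X (a · b)` — one multiplication in `Y`, converted to `X`, is the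
correctly rounded product of `X` (saturating RNE, subnormals kept).  The cells of the named matrix
were decided one at a time in `DoubleRoundingProductCells.lean` (`55` innocuous, `114` failing:
`102` non-embedded pairs and `12` embedded ones); the sum, quotient, FMA and square-root matrices
have a matrix-level theorem (`drAdd_named_iff`, `drDiv_named_iff`, `dFma_named_iff`,
`drSqrt_named_iff`).  This file is the product's:

* §1 THEOREM D-dm AS A BOOLEAN TEST on records, `drMulTest` = (I) `X = Y` ∨ (G) same grid with
  a larger top ∨ (`F_X ⊆ F_Y`, `P_Y ≥ 2 P_X`, and (E) `L_Y ≤ 2 L_X` — every product is a value of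
  `Y` or saturates — or (U) `L_Y + 2 P_X ≤ L_X`, `P_X ≥ 2` — the underflow clause), sound for
  EVERY pair of records (`drMul_of_test`); the `4` cells e2m1 → e3m2 / e5m2 / binary8p3 /
  binary8p3f (`P_Y = 3 < 2 P_X`) hold by kernel exhaustion only (`drMulXCells`; no record-level
  clause replaces them: a deeper `P = 2` source slips through a precision-`3` register at
  `9q/16 ↦ q/2 ↦ 0`, THEOREM N-mul-T); the precision strip as a test (`mulStripTest`,
  `not_drMul_of_stripTest`: `not_drMul_strip` of `DoubleRoundingStripLaws.lean`).
* §2 THE MATRIX `drMulPairs` (`55` pairs, `42` off the diagonal) `= namedPairs.filter (test ∨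
  exhaustion cell)` (`drMulPairs_eq_filter`) and the witness table of the `12` failing embedded
  cells (implementation A's first slips); §3 cell forms; §4 THEOREM D-dm on the named formats:
  `DRMul X Y ↔ (X, Y) ∈ drMulPairs` (`drMul_named_iff`, `169` cells), as one boolean evaluation
  (`drMul_named_iff_test`), `F_X ⊆ F_Y` necessary (`embeds_of_drMul_named`).
* §5 CLASSIFICATION: every failing embedded named cell satisfies EXACTLY ONE of four record-generic
  necessity tests — `mulStripTest` (`2`: e2m3 → binary8p5, binary8p5 → bfloat16),
  `drMulUnderflowTest` (N-mul-U, `1`: e5m2 → binary8p3f), `drMulTie9Test` (N-mul-T, `3`: e3m2 →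
  e5m2 / binary8p3 / binary8p3f), `drMulTie21Test` (N-mul-T, `6`: e3m2, e2m3 → e4m3 / binary8p4 /
  binary8p4f) —, none applies to an innocuous cell, so the matrix reads by laws:
  `DRMul X Y ↔ F_X ⊆ F_Y ∧ no necessity test` (`drMul_named_iff_laws`).

Two implementations: A = `code/enum/mul_matrix_laws.py` (exact rationals, two RNE
implementations; the test re-derived from the `13` records' `(P, L, M)`, the `55` cells and the
class counts `{I 13, G 2, E 32, U 4, X 4; N 102, W 12}` against
`certs/enum/DOUBLE-ROUNDING-MUL.json`, the `12` witnesses replayed, the classification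
`2 + 1 + 3 + 6`; the literals `drMulPairs`, `drMulWitTable`, `drMulXCells` and the tie cell lists
extracted from this file and `DoubleRoundingProductTie.lean` and asserted identical) →
`certs/enum/DOUBLE-ROUNDING-MUL-MATRIX.json`; B = the kernel (this file).  PLACEMENT — KNOWN:
innocuous double rounding of products for
`p₂ ≥ 2p₁` ([Figueroa1995, §3], unbounded exponents; [Roux2014, Table II] with gradual underflow
under `e_min₂ ≤ 2 e_min₁`, Coq/Flocq) — clause (E); binary32 products via binary64 are the textbook
instance ([MullerEtAl2018, §4.4]; [BoldoMelquiond2017, §1.4.2]); the failing side below the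
target's normal range is the x87 "double-rounding on underflow" ([Monniaux2007, §3.1.2]).  We
searched (2026-08-21) the held corpus (keyword + vector: "double rounding product FP8 bfloat16
binary16 table", `"double rounding" underflow extended precision`, a prose paraphrase of THEOREM
N-mul-T) and galaxy, all corpora ("double rounding|twice rounding|double-rounding", pdf "double
rounding"): hits were the textbook treatments, the x87 / `strictfp` literature (Monniaux;
Shudo-Muraoka 2000, §3.2) and the Flocq theorems; no decision table for the OCP / P3109 / IEEE
pairs and no statement of the register-tie family.  NEW here: the matrix as one kernel theorem
with a record-level test, and its failing side classified by four record-generic laws.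
No hardware or vendor claims.
-/

namespace Summit.Ventures.CertifiedArithmetic

open Literature.ComputerArithmetic.FloatingPoint
open Literature.ComputerArithmetic.FloatingPoint.Format
open Literature.ComputerArithmetic.FloatingPoint.MiniFloat

/-! ## §1 THEOREM D-dm as a boolean test; the exhaustion cells; the strip as a test -/

/-- THEOREM D-dm AS A BOOLEAN TEST on parameter records: (I) `φ = ψ`, or (G) the same grid with a
larger top, or `F_φ ⊆ F_ψ` (`embedsTest`), `P_ψ ≥ 2 P_φ` and — (E) `L_ψ ≤ 2 L_φ` (every product is
a `ψ`-value or saturates) or (U) `L_ψ + 2 P_φ ≤ L_φ` with `P_φ ≥ 2` (the underflow clause).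
Certified below to be right on the named pairs up to the `4` exhaustion cells `drMulXCells`.
[this packet; cite: Figueroa1995, §3; cite: Roux2014, Table II] -/
def drMulTest (φ ψ : Format) : Bool :=
  decide (φ = ψ) ||
  (decide (ψ.manBits = φ.manBits) && decide (ψ.emaxCode = φ.emaxCode) && decide (ψ.bias = φ.bias)
    && decide (φ.maxScaled ≤ ψ.maxScaled)) ||
  (embedsTest φ ψ && decide (2 * φ.manBits + 1 ≤ ψ.manBits) &&
    (decide (ψ.qexp ≤ 2 * φ.qexp) ||
      (decide (ψ.qexp + 2 * φ.manBits + 2 ≤ φ.qexp) && decide (1 ≤ φ.manBits))))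

/-- The test is sound for EVERY pair of records. [this packet] -/
theorem drMul_of_test {φ ψ : Format} (h : drMulTest φ ψ = true) : DRMul φ ψ := by
  simp only [drMulTest, Bool.or_eq_true, Bool.and_eq_true, decide_eq_true_eq] at h
  rcases h with (rfl | ⟨⟨⟨hm, he⟩, hb⟩, hM⟩) | ⟨⟨hE, hm⟩, hq | ⟨hu, h1⟩⟩
  · exact fun a b => toRat_roundNE_toRat _
  · exact fun a b => toRat_roundNE_roundNE_of_sameGrid hm he hb hM _
  · exact drMul_of_exact_of_embedsTest hE hm hq
  · exact drMul_of_underflow_of_embedsTest hE h1 hm hu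

/-- THE FOUR EXHAUSTION CELLS: e2m1 products through the precision-`3` registers (`P_Y = 3 <
2 P_X = 4`, outside every clause), innocuous by kernel exhaustion of the `16²` operand pairs
(`E2M1_mul_via_precision3`). [this packet] -/
def drMulXCells : List (Format × Format) :=
  [(E2M1, E3M2), (E2M1, E5M2), (E2M1, Binary8p3), (E2M1, Binary8p3F)]

/-- Dispatcher for `drMulXCells`. -/
theorem drCellMulX {X Y : Format} (hm : (X, Y) ∈ drMulXCells) : DRMul X Y := by
  simp only [drMulXCells, List.mem_cons, List.not_mem_nil, or_false, Prod.mk.injEq] at hm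
  rcases hm with ⟨rfl, rfl⟩ | ⟨rfl, rfl⟩ | ⟨rfl, rfl⟩ | ⟨rfl, rfl⟩
  exacts [E2M1_mul_via_precision3.1, E2M1_mul_via_precision3.2.1, E2M1_mul_via_precision3.2.2.1,
    E2M1_mul_via_precision3.2.2.2]

/-- NO RECORD-LEVEL CLAUSE REPLACES THE EXHAUSTION CELLS: a `P = 2` source one binade deeper than
e2m1 (`⟨1, 4, 4, 1⟩`, `L = -4`) slips through the precision-`3` register e5m2 (THEOREM N-mul-T,
`3q · 3q/... = 9q/16 ↦ q/2 ↦ 0`), while e2m1 itself (`L = -1`) cannot host the witness. -/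
example : ¬ DRMul ⟨1, 4, 4, 1, by decide⟩ E5M2 ∧ drMulTie9Test E2M1 E5M2 = false :=
  ⟨not_drMul_of_tie9Test (by decide +kernel), by decide +kernel⟩

/-- THE PRECISION STRIP AS A BOOLEAN TEST: the hypotheses of `not_drMul_strip`
(`DoubleRoundingStripLaws.lean`: `F_X ⊆ F_Y` by quantum and range, `P_X ≥ 4`,
`P_X < P_Y ≤ 2 P_X - 1`, biases `≥ 1`, `4` a value of `X`). [this packet] -/
def mulStripTest (X Y : Format) : Bool :=
  decide (Y.qexp ≤ X.qexp) &&
  decide (X.maxScaled * 2 ^ (X.qexp - Y.qexp).toNat ≤ Y.maxScaled) && decide (3 ≤ X.manBits) &&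
  decide (X.manBits < Y.manBits) && decide (Y.manBits ≤ 2 * X.manBits) && decide (1 ≤ X.bias) &&
  decide (1 ≤ Y.bias) && decide (2 ^ (X.manBits + X.bias + 1) ≤ X.maxScaled)

/-- SOUNDNESS: `mulStripTest X Y ⟹ ¬ DRMul X Y` (`not_drMul_strip`). [this packet] -/
theorem not_drMul_of_stripTest {X Y : Format} (h : mulStripTest X Y = true) : ¬ DRMul X Y := by
  simp only [mulStripTest, Bool.and_eq_true, decide_eq_true_eq] at h
  obtain ⟨⟨⟨⟨⟨⟨⟨hq, hM⟩, h3⟩, hP⟩, hP2⟩, hb⟩, hb'⟩, hR⟩ := h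
  exact not_drMul_strip hq hM h3 hP hP2 hb hb' hR

/-- ON THE NAMED MATRIX the strip test holds on exactly `2` cells, e2m3 → binary8p5 and
binary8p5 → bfloat16 (the strip cells of sources with `P ≥ 4`; e3m2's strip registers are tie
cells, e2m1's are innocuous). [this packet] -/
theorem mulStrip_named_iff : ∀ X ∈ namedFormats, ∀ Y ∈ namedFormats,
    mulStripTest X Y = true ↔ (X, Y) ∈ [(E2M3, Binary8p5), (Binary8p5, BFloat16)] := by
  decide +kernel

/-! ## §2 The matrix and the witnesses (transcribed from implementation A's certificate) -/

/-- THE MATRIX (THEOREM D-dm on the named records): the `55` ordered pairs `(X, Y)` with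
`DRMul X Y`, in the order of `namedFormats`; identical to implementation A's literal
(`certs/enum/DOUBLE-ROUNDING-MUL-MATRIX.json`, key `lean_literals`). [this packet] -/
def drMulPairs : List (Format × Format) := [
  (E2M1, E2M1), (E2M1, E3M2), (E2M1, E2M3), (E2M1, E4M3), (E2M1, E5M2), (E2M1, Binary8p3),
  (E2M1, Binary8p4), (E2M1, Binary8p5), (E2M1, Binary8p3F), (E2M1, Binary8p4F), (E2M1, Binary16),
  (E2M1, BFloat16), (E2M1, Binary32), (E3M2, E3M2), (E3M2, Binary16), (E3M2, BFloat16),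
  (E3M2, Binary32), (E2M3, E2M3), (E2M3, Binary16), (E2M3, BFloat16), (E2M3, Binary32),
  (E4M3, E4M3), (E4M3, Binary16), (E4M3, BFloat16), (E4M3, Binary32), (E5M2, E5M2),
  (E5M2, Binary16), (E5M2, BFloat16), (E5M2, Binary32), (Binary8p3, Binary8p3),
  (Binary8p3, Binary8p3F), (Binary8p3, Binary16), (Binary8p3, BFloat16), (Binary8p3, Binary32),
  (Binary8p4, Binary8p4), (Binary8p4, Binary8p4F), (Binary8p4, Binary16), (Binary8p4, BFloat16),
  (Binary8p4, Binary32), (Binary8p5, Binary8p5), (Binary8p5, Binary16), (Binary8p5, Binary32),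
  (Binary8p3F, Binary8p3F), (Binary8p3F, Binary16), (Binary8p3F, BFloat16), (Binary8p3F, Binary32),
  (Binary8p4F, Binary8p4F), (Binary8p4F, Binary16), (Binary8p4F, BFloat16), (Binary8p4F, Binary32),
  (Binary16, Binary16), (Binary16, Binary32), (BFloat16, BFloat16), (BFloat16, Binary32),
  (Binary32, Binary32)]

/-- `55` cells, `42` off the diagonal. -/
theorem drMulPairs_length :
    drMulPairs.length = 55 ∧ (drMulPairs.filter fun p => decide (p.1 ≠ p.2)).length = 42 := by
  decide

/-- THE MATRIX IS THE TEST PLUS THE FOUR EXHAUSTION CELLS: on the named pairs `drMulPairs` is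
exactly the filter of `drMulTest ∨ (· ∈ drMulXCells)`; the classes are (I) `13`, (G) `2`, (E) `32`,
(U) `4`, exhaustion `4`. [this packet] -/
theorem drMulPairs_eq_filter :
    drMulPairs = namedPairs.filter (fun p => drMulTest p.1 p.2 || decide (p ∈ drMulXCells)) := by
  decide +kernel

/-- Every cell of the matrix is an embedded pair (`F_X ⊆ F_Y`). [this packet] -/
theorem drMulPairs_embeds : ∀ p ∈ drMulPairs, embedsTest p.1 p.2 = true := by
  decide +kernel

/-- The witness table of the `12` failing embedded named cells: `(X, Y, a, b)` with `a b` values of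
`X`, implementation A's first slips (`certs/enum/DOUBLE-ROUNDING-MUL.json`), replayed here by the
kernel. [this packet] -/
def drMulWitTable : List (Format × Format × ℚ × ℚ) := [
  (E3M2, E4M3, 3/16, 7/8),
  (E3M2, E5M2, 3/16, 3/16),
  (E3M2, Binary8p3, 3/16, 3/16),
  (E3M2, Binary8p4, 3/16, 7/8),
  (E3M2, Binary8p3F, 3/16, 3/16),
  (E3M2, Binary8p4F, 3/16, 7/8),
  (E2M3, E4M3, 3/8, 7/8),
  (E2M3, Binary8p4, 3/8, 7/8),
  (E2M3, Binary8p5, 5/8, 15/8),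
  (E2M3, Binary8p4F, 3/8, 7/8),
  (E5M2, Binary8p3F, 1/65536, 5/8),
  (Binary8p5, BFloat16, 9/128, 31/16)]

/-- The tabulated witness of a cell (`(0, 0)` off the table). -/
def drMulWit (X Y : Format) : ℚ × ℚ :=
  ((drMulWitTable.find? fun e => decide (e.1 = X ∧ e.2.1 = Y)).map (·.2.2)).getD (0, 0)

/-! ## §3 Cell forms -/

/-- Witness replay: two rationals pushed through `fl_φ` are operands; if the two routes differ on
their product, `DRMul φ ψ` fails. [folklore] -/
theorem not_drMul_of_ne {φ ψ : Format} (ra rb : ℚ)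
    (h : (roundNE φ (roundNE ψ ((roundNE φ ra).toRat * (roundNE φ rb).toRat)).toRat).toRat
      ≠ (roundNE φ ((roundNE φ ra).toRat * (roundNE φ rb).toRat)).toRat) :
    ¬ DRMul φ ψ := fun hall => h (hall _ _)

/-- Cell form (I)/(G)/(E)/(U): the test holds. -/
theorem dmCellT {X Y : Format} (h : drMulTest X Y = true) (hm : (X, Y) ∈ drMulPairs) :
    DRMul X Y ↔ (X, Y) ∈ drMulPairs := iff_of_true (drMul_of_test h) hm

/-- Cell form (X): an exhaustion cell. -/
theorem dmCellX {X Y : Format} (h : (X, Y) ∈ drMulXCells) (hm : (X, Y) ∈ drMulPairs) :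
    DRMul X Y ↔ (X, Y) ∈ drMulPairs := iff_of_true (drCellMulX h) hm

/-- Cell form (N): a non-embedded named pair (embedding test `false`; round trip = embedding on
the named pairs, `RoundTripDecision.lean`; `1` is a value of `X`). -/
theorem dmCellN {X Y : Format} (hX : X ∈ namedFormats) (hY : Y ∈ namedFormats)
    (hone : ∃ o : MiniFloat X, o.toRat = 1) (he : embedsTest X Y = false)
    (hm : (X, Y) ∉ drMulPairs) : DRMul X Y ↔ (X, Y) ∈ drMulPairs :=
  iff_of_false (fun h => not_embeds_of_test (stdOperand_of_mem_namedFormats X hX) he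
    ((roundTrips_named_iff_embeds hX hY).mp (roundTrips_of_drMul hone h))) hm

/-- Cell form (W): a failing embedded pair, by its tabulated witness. -/
theorem dmCellW {X Y : Format}
    (h : (roundNE X (roundNE Y ((roundNE X (drMulWit X Y).1).toRat
        * (roundNE X (drMulWit X Y).2).toRat)).toRat).toRat
      ≠ (roundNE X ((roundNE X (drMulWit X Y).1).toRat * (roundNE X (drMulWit X Y).2).toRat)).toRat)
    (hm : (X, Y) ∉ drMulPairs) : DRMul X Y ↔ (X, Y) ∈ drMulPairs :=
  iff_of_false (not_drMul_of_ne _ _ h) hm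

/-! ## §4 THEOREM D-dm on the named formats -/

set_option maxHeartbeats 8000000 in
/-- THEOREM D-dm (the named formats): for named `X`, `Y`, one multiplication in `Y` converted to
`X` is the correctly rounded product of `X` iff `(X, Y)` is one of the `55` pairs of `drMulPairs`.
Each of the `169` cells is closed by the engine its class names: the test (I)/(G)/(E)/(U), an
exhaustion cell, non-embedding, or one witness. [this packet] -/
theorem drMul_named_iff {X Y : Format} (hX : X ∈ namedFormats) (hY : Y ∈ namedFormats) :
    DRMul X Y ↔ (X, Y) ∈ drMulPairs := by
  simp only [namedFormats, List.mem_cons, List.not_mem_nil, or_false] at hX hY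
  rcases hX with rfl | rfl | rfl | rfl | rfl | rfl | rfl | rfl | rfl | rfl | rfl | rfl | rfl <;>
  rcases hY with rfl | rfl | rfl | rfl | rfl | rfl | rfl | rfl | rfl | rfl | rfl | rfl | rfl
  all_goals first
    | exact dmCellT (by decide +kernel) (by decide +kernel)
    | exact dmCellX (by decide +kernel) (by decide +kernel)
    | exact dmCellN (by decide) (by decide) (exists_toRat_eq_one_of_mem_namedFormats _ (by decide))
        (by decide +kernel) (by decide +kernel)
    | exact dmCellW (by decide +kernel) (by decide +kernel)

/-- THEOREM D-dm AS ONE BOOLEAN EVALUATION: for named `X`, `Y`,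
`DRMul X Y ↔ drMulTest X Y ∨ (X, Y) ∈ drMulXCells`. [this packet] -/
theorem drMul_named_iff_test {X Y : Format} (hX : X ∈ namedFormats) (hY : Y ∈ namedFormats) :
    DRMul X Y ↔ (drMulTest X Y || decide ((X, Y) ∈ drMulXCells)) = true := by
  rw [drMul_named_iff hX hY, drMulPairs_eq_filter, List.mem_filter]
  exact ⟨fun h => h.2, fun h => ⟨mem_namedPairs hX hY, h⟩⟩

/-- Corollary: a correctly emulated multiplication needs `F_X ⊆ F_Y`. [this packet] -/
theorem embeds_of_drMul_named {X Y : Format} (hX : X ∈ namedFormats) (hY : Y ∈ namedFormats)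
    (h : DRMul X Y) : Embeds X Y :=
  (roundTrips_named_iff_embeds hX hY).mp
    (roundTrips_of_drMul (exists_toRat_eq_one_of_mem_namedFormats X hX) h)

/-! ## §5 Classification of the named × matrix by record-generic laws -/

/-- CLASSIFICATION.  Every failing cell `X ⊆ Y` (`embedsTest`, `∉ drMulPairs`) of the named ×
matrix satisfies EXACTLY ONE of the four record-generic necessity tests: `mulStripTest` (`2`
cells), `drMulUnderflowTest` (N-mul-U, `1`), `drMulTie9Test` (N-mul-T, `3`), `drMulTie21Test`
(N-mul-T, `6`): ALL `12` failing embedded cells are instances of laws quantified over every pair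
of records; the `102` non-embedded pairs fail by `embeds_of_drMul_named`, and the `55` holding
cells hold by `drMul_of_test` / exhaustion. [this packet] -/
theorem drMul_named_failing_classified : ∀ X ∈ namedFormats, ∀ Y ∈ namedFormats,
    embedsTest X Y = true → (X, Y) ∉ drMulPairs →
    [mulStripTest X Y, drMulUnderflowTest X Y, drMulTie9Test X Y, drMulTie21Test X Y].count true
      = 1 := by
  decide +kernel

/-- NO LAW APPLIES TO AN INNOCUOUS CELL (consistency of the four tests with the matrix, checked
by the kernel independently of their soundness proofs). [this packet] -/
theorem drMul_named_laws_off_matrix : ∀ X ∈ namedFormats, ∀ Y ∈ namedFormats,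
    (X, Y) ∈ drMulPairs → mulStripTest X Y = false ∧ drMulUnderflowTest X Y = false ∧
      drMulTie9Test X Y = false ∧ drMulTie21Test X Y = false := by
  decide +kernel

/-- THE FOUR LAWS DECIDE EVERY FAILING NAMED CELL: `¬ DRMul X Y` for every failing embedded cell,
by the record-generic theorem its test selects (no witness table). [this packet] -/
theorem not_drMul_named_of_laws : ∀ X ∈ namedFormats, ∀ Y ∈ namedFormats,
    embedsTest X Y = true → (X, Y) ∉ drMulPairs → ¬ DRMul X Y := by
  have key : ∀ X ∈ namedFormats, ∀ Y ∈ namedFormats, embedsTest X Y = true → (X, Y) ∉ drMulPairs →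
      mulStripTest X Y = true ∨ drMulUnderflowTest X Y = true ∨ drMulTie9Test X Y = true ∨
        drMulTie21Test X Y = true := by
    decide +kernel
  intro X hX Y hY he hn
  rcases key X hX Y hY he hn with h | h | h | h
  · exact not_drMul_of_stripTest h
  · exact not_drMul_of_underflowTest h
  · exact not_drMul_of_tie9Test h
  · exact not_drMul_of_tie21Test h

/-- THE NAMED × MATRIX READ BY LAWS: `DRMul X Y` iff `F_X ⊆ F_Y` and none of the four necessity
tests applies — the `55` holding cells by `drMul_named_iff`, the failing direction by
`embeds_of_drMul_named` and the four soundness theorems. [this packet] -/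
theorem drMul_named_iff_laws {X Y : Format} (hX : X ∈ namedFormats) (hY : Y ∈ namedFormats) :
    DRMul X Y ↔ embedsTest X Y = true ∧ mulStripTest X Y = false ∧
      drMulUnderflowTest X Y = false ∧ drMulTie9Test X Y = false ∧ drMulTie21Test X Y = false := by
  constructor
  · intro h
    have he := (embeds_iff_test (stdOperand_of_mem_namedFormats X hX)).mp
      (embeds_of_drMul_named hX hY h)
    refine ⟨he, ?_, ?_, ?_, ?_⟩
    · cases hS : mulStripTest X Y
      · rfl
      · exact absurd h (not_drMul_of_stripTest hS)
    · cases hU : drMulUnderflowTest X Y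
      · rfl
      · exact absurd h (not_drMul_of_underflowTest hU)
    · cases h9 : drMulTie9Test X Y
      · rfl
      · exact absurd h (not_drMul_of_tie9Test h9)
    · cases h21 : drMulTie21Test X Y
      · rfl
      · exact absurd h (not_drMul_of_tie21Test h21)
  · intro h
    rw [drMul_named_iff hX hY]
    have key : ∀ X ∈ namedFormats, ∀ Y ∈ namedFormats,
        embedsTest X Y = true ∧ mulStripTest X Y = false ∧ drMulUnderflowTest X Y = false ∧
          drMulTie9Test X Y = false ∧ drMulTie21Test X Y = false → (X, Y) ∈ drMulPairs := by
      decide +kernel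
    exact key X hX Y hY h

/-! ### Readings (kernel instances; statements about the formats' arithmetic only) -/

/-- Through binary32 every named format's multiplication is correctly emulated; through binary16
and bfloat16 every FP8 / FP6 / FP4 record's — except binary8p5 through bfloat16 (`P = 8 < 2·5`,
the strip: `9/128 · 31/16 ↦ 35/256 ↦ 1/8`, directly `9/64`) —; no FP6 multiplication is emulated
through an FP8 format, e2m1's through every named register. -/
example : DRMul E4M3 BFloat16 ∧ DRMul E5M2 Binary16 ∧ DRMul Binary8p5 Binary16 ∧
    DRMul E2M3 BFloat16 ∧ DRMul Binary16 Binary32 ∧ DRMul BFloat16 Binary32 ∧ DRMul E2M1 E4M3 ∧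
    ¬ DRMul Binary8p5 BFloat16 ∧ ¬ DRMul E3M2 E4M3 ∧ ¬ DRMul E2M3 E4M3 ∧ ¬ DRMul E3M2 E5M2 :=
  ⟨drMul_of_test (by decide +kernel), drMul_of_test (by decide +kernel),
    drMul_of_test (by decide +kernel), drMul_of_test (by decide +kernel),
    drMul_of_test (by decide +kernel), drMul_of_test (by decide +kernel),
    drMul_of_test (by decide +kernel), not_drMul_of_stripTest (by decide +kernel),
    not_drMul_of_tie21Test (by decide +kernel), not_drMul_of_tie21Test (by decide +kernel),
    not_drMul_of_tie9Test (by decide +kernel)⟩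

end Summit.Ventures.CertifiedArithmetic
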